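import Literature.Topology.FourManifolds.CircleFamilies
import HarnessLib

/-!
# Maps on the circle from `2π`-periodic maps on the line

Topic `Literature/Topology/FourManifolds`; infrastructure for building loops `S¹ → X` out of
`2π`-periodic maps `ℝ → X` along the parametrisation `circlePoint : ℝ → S¹`
(`θ ↦ (cos θ, sin θ)`, `Knots.lean`), used by the tree's proof of the arc-closing lemma of
Milnor's proof of Lemma 8.3 (`Milnor1965_exists_embedding_circle_through_arc`,
`HCobordismIdealCircleLemma83.lean`).  Everything here is proved; no definitions, no named facts.

* `Literature.Topology.FourManifolds.isQuotientMap_circlePoint` — `circlePoint` is a quotient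
  map (a surjective open map: it is a covering map, `isCoveringMap_circlePoint`,
  `CircleDiffeotopyProofs.lean`); hence `Literature.Topology.FourManifolds.continuous_of_comp_circlePoint`:
  a map on the circle is continuous iff its composition with `circlePoint` is.
* `Literature.Topology.FourManifolds.exists_fun_comp_circlePoint_eq` — a `2π`-periodic map on
  `ℝ` is of the form `L ∘ circlePoint`.
* `Literature.Topology.FourManifolds.contMDiffAt_of_comp_circlePoint` — if `L ∘ circlePoint` is
  `C^∞` at `θ` then `L` is `C^∞` at `circlePoint θ` (through the smooth local angle functions
  `angA`, `angB` of `TorusCoordinates.lean`).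

## References

* M. W. Hirsch, *Differential Topology*, GTM 33 (1976), Ch. 1 §1 (the circle as a quotient of
  the line). [HirschDT1976]
-/

open scoped Manifold ContDiff Topology Real
open Function Set Filter

noncomputable section

namespace Literature.Topology.FourManifolds

/-! ### `circlePoint` is a quotient map -/

/-- `circlePoint : ℝ → S¹` is an open map (it is a covering map). [folklore] -/
theorem isOpenMap_circlePoint : IsOpenMap circlePoint :=
  isCoveringMap_circlePoint.isLocalHomeomorph.isOpenMap

/-- `circlePoint : ℝ → S¹` is a quotient map. [folklore] -/
theorem isQuotientMap_circlePoint : Topology.IsQuotientMap circlePoint :=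
  isOpenMap_circlePoint.isQuotientMap continuous_circlePoint circlePoint_surjective

/-- **A map on the circle is continuous iff its lift along `circlePoint` is.** [folklore] -/
theorem continuous_of_comp_circlePoint {X : Type*} [TopologicalSpace X] {L : (Metric.sphere (0 : EuclideanSpace ℝ (Fin 2)) 1) → X}
    (h : Continuous (L ∘ circlePoint)) : Continuous L :=
  isQuotientMap_circlePoint.continuous_iff.2 h

/-- **A `2π`-periodic map on the line descends to the circle.** [folklore] -/
theorem exists_fun_comp_circlePoint_eq {X : Type*} {P : ℝ → X} (hP : Periodic P (2 * π)) :
    ∃ L : (Metric.sphere (0 : EuclideanSpace ℝ (Fin 2)) 1) → X, ∀ θ, L (circlePoint θ) = P θ := by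
  refine ⟨fun u => P (Classical.choose (circlePoint_surjective u)), fun θ => ?_⟩
  exact Periodic.eq_of_circlePoint_eq hP
    (Classical.choose_spec (circlePoint_surjective (circlePoint θ)))

/-! ### Smoothness descends along `circlePoint` -/

/-- The lift of a map on the circle is `2π`-periodic. [folklore] -/
theorem periodic_comp_circlePoint {X : Type*} (L : (Metric.sphere (0 : EuclideanSpace ℝ (Fin 2)) 1) → X) : Periodic (L ∘ circlePoint) (2 * π) :=
  fun θ => by simp only [comp_apply, circlePoint_add_two_pi]

/-- Smoothness of the lift at one angle gives smoothness at every angle with the same point of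
the circle (composition with a translation by a multiple of `2π`). [folklore] -/
theorem contMDiffAt_comp_circlePoint_of_circlePoint_eq {E' H' : Type*} [NormedAddCommGroup E']
    [NormedSpace ℝ E'] [TopologicalSpace H'] {J : ModelWithCorners ℝ E' H'} {N : Type*}
    [TopologicalSpace N] [ChartedSpace H' N] {L : (Metric.sphere (0 : EuclideanSpace ℝ (Fin 2)) 1) → N} {θ θ' : ℝ}
    (h : ContMDiffAt 𝓘(ℝ, ℝ) J ∞ (L ∘ circlePoint) θ) (hθ : circlePoint θ' = circlePoint θ) :
    ContMDiffAt 𝓘(ℝ, ℝ) J ∞ (L ∘ circlePoint) θ' := by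
  obtain ⟨k, hk⟩ := exists_eq_add_of_circlePoint_eq hθ
  -- `L ∘ circlePoint = (L ∘ circlePoint) ∘ (· - k 2π)` and `θ' - k 2π = θ`
  have heq : (L ∘ circlePoint) = (L ∘ circlePoint) ∘ fun x : ℝ => x - (k : ℝ) * (2 * π) := by
    funext x
    simp only [comp_apply]
    congr 1
    rw [circlePoint_eq_circlePoint_iff]
    exact ⟨k, by ring⟩
  rw [heq]
  refine ContMDiffAt.comp θ' ?_ ((contDiff_id.sub contDiff_const).contMDiff.contMDiffAt)
  have : θ' - (k : ℝ) * (2 * π) = θ := by rw [hk]; ring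
  rw [this]
  exact h

/-- **Smoothness descends along `circlePoint`**: if `L ∘ circlePoint` is `C^∞` at `θ` then `L`
is `C^∞` at `circlePoint θ` — through one of the two smooth local angle functions `angA`,
`angB` of the circle (`TorusCoordinates.lean`), which are right inverses of
`θ ↦ circlePoint (2π θ)`. [folklore] -/
theorem contMDiffAt_of_comp_circlePoint {E' H' : Type*} [NormedAddCommGroup E']
    [NormedSpace ℝ E'] [TopologicalSpace H'] {J : ModelWithCorners ℝ E' H'} {N : Type*}
    [TopologicalSpace N] [ChartedSpace H' N] {L : (Metric.sphere (0 : EuclideanSpace ℝ (Fin 2)) 1) → N} {θ : ℝ}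
    (h : ContMDiffAt 𝓘(ℝ, ℝ) J ∞ (L ∘ circlePoint) θ) :
    ContMDiffAt (𝓡 1) J ∞ L (circlePoint θ) := by
  set u := circlePoint θ with hu
  by_cases hA : u ≠ ptA
  · -- through `angA`
    have hsec : ∀ v : (Metric.sphere (0 : EuclideanSpace ℝ (Fin 2)) 1), circlePoint (2 * π * angA v) = v := circlePoint_two_pi_mul_angA
    have hL : L = (L ∘ circlePoint) ∘ fun v : (Metric.sphere (0 : EuclideanSpace ℝ (Fin 2)) 1) => 2 * π * angA v := by
      funext v
      simp only [comp_apply, hsec v]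
    have hθ' : circlePoint (2 * π * angA u) = circlePoint θ := by rw [hsec u]
    have h' := contMDiffAt_comp_circlePoint_of_circlePoint_eq h hθ'
    rw [hL]
    exact h'.comp u
      ((contDiff_const.mul contDiff_id).contDiffAt.comp_contMDiffAt (contMDiffAt_angA hA))
  · -- `u = ptA ≠ ptB`: through `angB`
    rw [not_not] at hA
    have hB : u ≠ ptB := hA ▸ ptA_ne_ptB
    have hsec : ∀ v : (Metric.sphere (0 : EuclideanSpace ℝ (Fin 2)) 1), circlePoint (2 * π * angB v) = v := circlePoint_two_pi_mul_angB
    have hL : L = (L ∘ circlePoint) ∘ fun v : (Metric.sphere (0 : EuclideanSpace ℝ (Fin 2)) 1) => 2 * π * angB v := by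
      funext v
      simp only [comp_apply, hsec v]
    have hθ' : circlePoint (2 * π * angB u) = circlePoint θ := by rw [hsec u]
    have h' := contMDiffAt_comp_circlePoint_of_circlePoint_eq h hθ'
    rw [hL]
    exact h'.comp u
      ((contDiff_const.mul contDiff_id).contDiffAt.comp_contMDiffAt (contMDiffAt_angB hB))

/-- **Smoothness descends along `circlePoint`, on open sets of angles**: if `L ∘ circlePoint` is
`C^∞` on an open set `Θ ⊆ ℝ` then `L` is `C^∞` at every `circlePoint θ`, `θ ∈ Θ`. [folklore] -/
theorem contMDiffAt_of_contMDiffOn_comp_circlePoint {E' H' : Type*} [NormedAddCommGroup E']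
    [NormedSpace ℝ E'] [TopologicalSpace H'] {J : ModelWithCorners ℝ E' H'} {N : Type*}
    [TopologicalSpace N] [ChartedSpace H' N] {L : (Metric.sphere (0 : EuclideanSpace ℝ (Fin 2)) 1) → N} {Θ : Set ℝ} (hΘ : IsOpen Θ)
    (h : ContMDiffOn 𝓘(ℝ, ℝ) J ∞ (L ∘ circlePoint) Θ) {θ : ℝ} (hθ : θ ∈ Θ) :
    ContMDiffAt (𝓡 1) J ∞ L (circlePoint θ) :=
  contMDiffAt_of_comp_circlePoint (h.contMDiffAt (hΘ.mem_nhds hθ))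

/-! ### The velocity of a loop built from a curve -/

section Velocity

variable {n : ℕ} {V : Type*} [TopologicalSpace V] [ChartedSpace (EuclideanSpace ℝ (Fin n)) V]

set_option backward.isDefEq.respectTransparency false in
/-- **Velocity of a loop which is a given curve near an angle.**  If the lift of `L : S¹ → V`
agrees near `θ` with a curve `r ↦ γ (r - d)` (a translate of `γ`), and `γ` has injective
differential at `θ - d`, then the constant family of `L` has nonzero θ-velocity at `θ`.
[folklore] -/
theorem thetaVel_const_ne_zero_of_eventuallyEq_curve {L : (Metric.sphere (0 : EuclideanSpace ℝ (Fin 2)) 1) → V} {γ : ℝ → V} {θ d : ℝ}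
    (hγ : ContMDiff 𝓘(ℝ, ℝ) (𝓡 n) ∞ γ) (hinj : Injective (mfderiv 𝓘(ℝ, ℝ) (𝓡 n) γ (θ - d)))
    (heq : (L ∘ circlePoint) =ᶠ[𝓝 θ] fun r => γ (r - d)) :
    thetaVel n (fun p : ℝ × (Metric.sphere (0 : EuclideanSpace ℝ (Fin 2)) 1) => L p.2) 0 θ ≠ 0 := by
  have hn : (∞ : WithTop ℕ∞) ≠ 0 := by simp
  -- the velocity is that of `r ↦ γ (r - d)` at `θ`
  have h1 : thetaVel n (fun p : ℝ × (Metric.sphere (0 : EuclideanSpace ℝ (Fin 2)) 1) => L p.2) 0 θ =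
      mfderiv 𝓘(ℝ, ℝ) (𝓡 n) (fun r => γ (r - d)) θ (1 : ℝ) := by
    unfold thetaVel
    exact congrArg (fun M : ℝ →L[ℝ] EuclideanSpace ℝ (Fin n) => M (1 : ℝ)) heq.mfderiv_eq
  rw [h1]
  -- chain rule with the translation
  have hsub : ContMDiff 𝓘(ℝ, ℝ) 𝓘(ℝ, ℝ) ∞ fun r : ℝ => r - d :=
    (contDiff_id.sub contDiff_const).contMDiff
  have hcomp : mfderiv 𝓘(ℝ, ℝ) (𝓡 n) (γ ∘ fun r : ℝ => r - d) θ =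
      (mfderiv 𝓘(ℝ, ℝ) (𝓡 n) γ (θ - d)).comp (mfderiv 𝓘(ℝ, ℝ) 𝓘(ℝ, ℝ) (fun r : ℝ => r - d) θ) :=
    mfderiv_comp θ (hγ.mdifferentiableAt hn) (hsub.mdifferentiableAt hn)
  have htr : mfderiv 𝓘(ℝ, ℝ) 𝓘(ℝ, ℝ) (fun r : ℝ => r - d) θ (1 : ℝ) = (1 : ℝ) := by
    have : HasMFDerivAt 𝓘(ℝ, ℝ) 𝓘(ℝ, ℝ) (fun r : ℝ => r - d) θ (ContinuousLinearMap.id ℝ ℝ) :=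
      ((hasFDerivAt_id θ).sub_const d).hasMFDerivAt
    rw [this.mfderiv]
    rfl
  intro h0
  have key : (mfderiv 𝓘(ℝ, ℝ) (𝓡 n) γ (θ - d))
      (mfderiv 𝓘(ℝ, ℝ) 𝓘(ℝ, ℝ) (fun r : ℝ => r - d) θ (1 : ℝ)) = 0 := by
    have := congrArg (fun M : ℝ →L[ℝ] EuclideanSpace ℝ (Fin n) => M (1 : ℝ)) hcomp
    exact this.symm.trans h0
  rw [htr] at key
  have h10 : (1 : ℝ) = 0 := hinj (key.trans (map_zero _).symm)
  exact one_ne_zero h10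

end Velocity

end Literature.Topology.FourManifolds
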